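import Mathlib.Topology.Bases
import Mathlib.Topology.Separation.Hausdorff
import Mathlib.Topology.Compactness.Compact
import Mathlib.Topology.OpenPartialHomeomorph.Constructions
import Mathlib.Topology.Homeomorph.Lemmas
import HarnessLib

/-!
# The orbit space of a continuous involution

Topic `Literature/Topology`; namespace `Literature.Topology`. Point-set topology of the orbit
space `X/σ` of a continuous involution `σ` of a topological space `X` — the topological half of
the Arnold–Kuiper–Massey–Finashin quotient `X → X/conj` of a real surface (tree files
`Topology/FourManifolds/BranchedDoubleQuotient.lean`, `ConjQuotientSmoothing.lean`) — stated for an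
arbitrary setoid `s` on `X` whose relation is "same `σ`-orbit", `s x y ↔ y = x ∨ y = σ x`, so
that consumers may realise the orbit space as `Quotient s` for the setoid of their choice (no
definitions are introduced here):

* `mk_eq_mk_iff`, `preimage_image_mk`, `isOpenMap_mk`, `isQuotientMap_mk` — the projection
  `q : X → X/σ` has fibres the orbits `{x, σ x}`, saturates `A` to `A ∪ σ(A)`, and is an open
  quotient map;
* `secondCountableTopology_quotient`, `t2Space_quotient` — `X/σ` is second countable /
  Hausdorff when `X` is (compactness is Mathlib's instance `Quotient.compactSpace`);
* `exists_nhds_disjoint_image` — a non-fixed point has arbitrarily small open neighbourhoods `U`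
  with `U ∩ σ(U) = ∅`; `exists_openPartialHomeomorph_mk_of_disjoint` — on such `U` the
  projection is an open embedding, inverted by an open partial homeomorphism `X/σ ⇀ X` (the
  local sections giving the covering charts off the branch locus);
* `liftOut_mk`, `continuousOn_liftOut` — a map `g` on a `σ`-invariant open set `W` with
  `g ∘ σ = g` descends to `z ↦ g z.out` on `q(W)`, continuously if `g` is.

All statements are standard (Bredon, *Introduction to compact transformation groups* (1972),
Ch. I §3: orbit spaces of compact — here finite — group actions are Hausdorff, the orbit map is
open and closed). [folklore]

## References

* [Bredon1972] G. E. Bredon, *Introduction to compact transformation groups*, Academic Press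
  (1972), Ch. I §3.
-/

noncomputable section

open Set Function Filter
open _root_.Topology

namespace Literature.Topology

namespace InvolutionOrbitSpace

section Algebra

variable {X : Type*} {σ : X → X} {s : Setoid X}

/-- The orbit relation of an involution, as a hypothesis on a setoid: `s x y ↔ y = x ∨ y = σ x`.
(For `σ` an involution this relation is an equivalence relation; consumers build the setoid.)
[folklore] -/
theorem equivalence_orbitRel (hσ : Involutive σ) :
    Equivalence fun x y : X ↦ y = x ∨ y = σ x where
  refl x := Or.inl rfl
  symm := by
    rintro x y (rfl | rfl)
    · exact Or.inl rfl
    · exact Or.inr (hσ x).symm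
  trans := by
    rintro x y z (rfl | rfl) (rfl | rfl)
    · exact Or.inl rfl
    · exact Or.inr rfl
    · exact Or.inr rfl
    · exact Or.inl (hσ x)

/-- **Fibres of the projection**: `q x = q y ↔ y = x ∨ y = σ x`. [folklore] -/
theorem mk_eq_mk_iff (hs : ∀ x y, s x y ↔ y = x ∨ y = σ x) (x y : X) :
    Quotient.mk s x = Quotient.mk s y ↔ y = x ∨ y = σ x := by
  rw [Quotient.eq, hs]

/-- `q (σ x) = q x`. [folklore] -/
theorem mk_apply (hs : ∀ x y, s x y ↔ y = x ∨ y = σ x) (x : X) :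
    Quotient.mk s (σ x) = Quotient.mk s x :=
  ((mk_eq_mk_iff hs x (σ x)).2 (Or.inr rfl)).symm

/-- **Saturation**: `q ⁻¹' (q '' A) = A ∪ σ '' A`. [folklore] -/
theorem preimage_image_mk (hs : ∀ x y, s x y ↔ y = x ∨ y = σ x) (A : Set X) :
    Quotient.mk s ⁻¹' (Quotient.mk s '' A) = A ∪ σ '' A := by
  ext y
  simp only [mem_preimage, mem_image, mem_union]
  constructor
  · rintro ⟨x, hx, hxy⟩
    rcases (mk_eq_mk_iff hs x y).1 hxy with rfl | rfl
    · exact Or.inl hx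
    · exact Or.inr ⟨_, hx, rfl⟩
  · rintro (hy | ⟨x, hx, rfl⟩)
    · exact ⟨y, hy, rfl⟩
    · exact ⟨x, hx, (mk_apply hs x).symm⟩

/-- The saturation of a `σ`-invariant set is itself. [folklore] -/
theorem preimage_image_mk_of_mapsTo (hs : ∀ x y, s x y ↔ y = x ∨ y = σ x)
    {A : Set X} (hA : MapsTo σ A A) : Quotient.mk s ⁻¹' (Quotient.mk s '' A) = A := by
  rw [preimage_image_mk hs, union_eq_left]
  rintro _ ⟨x, hx, rfl⟩
  exact hA hx

/-- For an involution, `σ '' U = σ ⁻¹' U`. [folklore] -/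
theorem image_eq_preimage (hσ : Involutive σ) (U : Set X) : σ '' U = σ ⁻¹' U := by
  ext y
  constructor
  · rintro ⟨x, hx, rfl⟩
    simpa [mem_preimage, hσ x] using hx
  · intro hy
    exact ⟨σ y, hy, hσ y⟩

/-- **The projection is injective on a set disjoint from its `σ`-image.** [folklore] -/
theorem injOn_mk_of_disjoint (hs : ∀ x y, s x y ↔ y = x ∨ y = σ x) {U : Set X}
    (hU : ∀ y ∈ U, σ y ∉ U) : InjOn (Quotient.mk s) U := by
  intro x hx y hy hxy
  rcases (mk_eq_mk_iff hs x y).1 hxy with rfl | rfl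
  · rfl
  · exact absurd hy (hU x hx)

/-- **A representative of `q y` is `y` or `σ y`.** [folklore] -/
theorem out_mk_eq_or (hs : ∀ x y, s x y ↔ y = x ∨ y = σ x) (y : X) :
    (Quotient.mk s y).out = y ∨ (Quotient.mk s y).out = σ y :=
  (mk_eq_mk_iff hs y _).1 (Quotient.out_eq _).symm

/-- **Descending a `σ`-invariant map through representatives**: if `g (σ y) = g y` on a
`σ`-invariant set `W`, then `g (q y).out = g y` for `y ∈ W`. [folklore] -/
theorem liftOut_mk {Z : Type*} (hs : ∀ x y, s x y ↔ y = x ∨ y = σ x) {W : Set X}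
    {g : X → Z} (hg : ∀ y ∈ W, g (σ y) = g y) {y : X} (hy : y ∈ W) :
    g (Quotient.mk s y).out = g y := by
  rcases out_mk_eq_or hs y with h | h
  · rw [h]
  · rw [h, hg y hy]

/-- Points of `q(W)` have representatives in `W` when `W` is `σ`-invariant. [folklore] -/
theorem out_mem_of_mem_image (hs : ∀ x y, s x y ↔ y = x ∨ y = σ x) {W : Set X}
    (hW : MapsTo σ W W) {z : Quotient s} (hz : z ∈ Quotient.mk s '' W) : z.out ∈ W := by
  obtain ⟨y, hy, rfl⟩ := hz
  rcases out_mk_eq_or hs y with h | h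
  · rwa [h]
  · rw [h]; exact hW hy

/-- The descended map composed with the projection is the original map on `W`. [folklore] -/
theorem liftOut_comp_mk_eqOn {Z : Type*} (hs : ∀ x y, s x y ↔ y = x ∨ y = σ x) {W : Set X}
    {g : X → Z} (hg : ∀ y ∈ W, g (σ y) = g y) :
    EqOn ((fun z : Quotient s ↦ g z.out) ∘ Quotient.mk s) g W := fun _ hy ↦
  liftOut_mk hs hg hy

end Algebra

section Topology

variable {X : Type*} [TopologicalSpace X] {σ : X → X} {s : Setoid X}

/-- The projection is a quotient map (Mathlib). [folklore] -/
theorem isQuotientMap_mk : IsQuotientMap (Quotient.mk s : X → Quotient s) :=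
  isQuotientMap_quotient_mk'

/-- **The projection of the orbit space of a continuous involution is an open map**: the
saturation `A ∪ σ(A) = A ∪ σ⁻¹(A)` of an open set is open. [folklore] -/
theorem isOpenMap_mk (hs : ∀ x y, s x y ↔ y = x ∨ y = σ x) (hσ : Involutive σ)
    (hc : Continuous σ) : IsOpenMap (Quotient.mk s : X → Quotient s) := by
  intro U hU
  rw [← (isQuotientMap_mk (s := s)).isOpen_preimage, preimage_image_mk hs,
    image_eq_preimage hσ]
  exact hU.union (hU.preimage hc)

/-- The image of an open set under the projection is open. [folklore] -/
theorem isOpen_image_mk (hs : ∀ x y, s x y ↔ y = x ∨ y = σ x) (hσ : Involutive σ)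
    (hc : Continuous σ) {U : Set X} (hU : IsOpen U) : IsOpen (Quotient.mk s '' U) :=
  isOpenMap_mk hs hσ hc U hU

/-- **The orbit space of a continuous involution of a second countable space is second
countable** (open quotient of a second countable space). [folklore] -/
theorem secondCountableTopology_quotient [SecondCountableTopology X]
    (hs : ∀ x y, s x y ↔ y = x ∨ y = σ x) (hσ : Involutive σ) (hc : Continuous σ) :
    SecondCountableTopology (Quotient s) :=
  (isQuotientMap_mk (s := s)).secondCountableTopology (isOpenMap_mk hs hσ hc)

/-- **The orbit space of a continuous involution of a Hausdorff space is Hausdorff**: two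
distinct orbits `{x, σ x}`, `{y, σ y}` are disjoint compact sets, separated by disjoint open sets
which may be taken `σ`-invariant (intersect with the `σ`-preimage); their images are disjoint
open neighbourhoods in the quotient. Bredon (1972), I.3.1. [folklore] -/
theorem t2Space_quotient [T2Space X] (hs : ∀ x y, s x y ↔ y = x ∨ y = σ x) (hσ : Involutive σ)
    (hc : Continuous σ) : T2Space (Quotient s) := by
  rw [t2Space_iff]
  intro a b hab
  obtain ⟨x, rfl⟩ := Quotient.mk_surjective a
  obtain ⟨y, rfl⟩ := Quotient.mk_surjective b
  -- the two orbits are disjoint compact sets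
  set K : Set X := {x, σ x} with hK
  set L : Set X := {y, σ y} with hL
  have hKL : Disjoint K L := by
    rw [hK, hL, disjoint_iff_forall_ne]
    rintro u hu v hv huv
    simp only [mem_insert_iff, mem_singleton_iff] at hu hv
    apply hab
    rw [mk_eq_mk_iff hs]
    rcases hu with hu | hu <;> rcases hv with hv | hv
    · exact Or.inl (by rw [← hu, huv, hv])
    · exact Or.inr (by rw [← hu, huv, hv, hσ y])
    · exact Or.inr (by rw [← hu, huv, hv])
    · exact Or.inl (hσ.injective (by rw [← hu, huv, hv])).symm
  obtain ⟨U, V, hU, hV, hKU, hLV, hUV⟩ :=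
    SeparatedNhds.of_isCompact_isCompact (hK ▸ (toFinite _).isCompact)
      (hL ▸ (toFinite _).isCompact) hKL
  -- `σ`-invariant shrinkings
  set U' := U ∩ σ ⁻¹' U with hU'
  set V' := V ∩ σ ⁻¹' V with hV'
  have hU'o : IsOpen U' := hU.inter (hU.preimage hc)
  have hV'o : IsOpen V' := hV.inter (hV.preimage hc)
  have hxU' : x ∈ U' := ⟨hKU (by simp [hK]), hKU (by simp [hK])⟩
  have hyV' : y ∈ V' := ⟨hLV (by simp [hL]), hLV (by simp [hL])⟩
  refine ⟨Quotient.mk s '' U', Quotient.mk s '' V', isOpen_image_mk hs hσ hc hU'o,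
    isOpen_image_mk hs hσ hc hV'o, mem_image_of_mem _ hxU', mem_image_of_mem _ hyV', ?_⟩
  rw [disjoint_iff_forall_ne]
  rintro _ ⟨u, hu, rfl⟩ _ ⟨v, hv, rfl⟩ huv
  rcases (mk_eq_mk_iff hs u v).1 huv with rfl | rfl
  · exact hUV.ne_of_mem hu.1 hv.1 rfl
  · exact hUV.ne_of_mem hu.2 hv.1 rfl

/-! ### Small neighbourhoods of non-fixed points and local sections -/

/-- **A non-fixed point of a continuous involution of a Hausdorff space has arbitrarily small
open neighbourhoods `U` with `U ∩ σ(U) = ∅`.** [folklore] -/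
theorem exists_nhds_disjoint_image [T2Space X] (hc : Continuous σ) {x : X}
    (hx : σ x ≠ x) {N : Set X} (hN : N ∈ 𝓝 x) :
    ∃ U : Set X, IsOpen U ∧ x ∈ U ∧ U ⊆ N ∧ ∀ y ∈ U, σ y ∉ U := by
  obtain ⟨V₁, V₂, hV₁, hV₂, hx₁, hx₂, hdisj⟩ := t2_separation hx.symm
  obtain ⟨O, hON, hO, hxO⟩ := mem_nhds_iff.1 hN
  refine ⟨O ∩ V₁ ∩ σ ⁻¹' V₂, (hO.inter hV₁).inter (hV₂.preimage hc), ⟨⟨hxO, hx₁⟩, hx₂⟩,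
    fun y hy ↦ hON hy.1.1, fun y hy hy' ↦ ?_⟩
  exact hdisj.ne_of_mem hy'.1.2 hy.2 rfl

/-- **Local sections of the projection off the fixed points.** If `U` is open with
`U ∩ σ(U) = ∅`, the projection restricted to `U` is an open embedding: there is an open partial
homeomorphism `e : X ⇀ X/σ` which is the projection as a function, with source `U` and target
`q(U)`, so that `e.symm` is a continuous local section of `q` over `q(U)` with values in `U`
(the covering charts of `X/σ` off the branch locus are `e.symm` followed by charts of `X`).
[folklore] -/
theorem exists_openPartialHomeomorph_mk_of_disjoint [Nonempty X]
    (hs : ∀ x y, s x y ↔ y = x ∨ y = σ x) (hσ : Involutive σ) (hc : Continuous σ) {U : Set X}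
    (hUo : IsOpen U) (hU : ∀ y ∈ U, σ y ∉ U) :
    ∃ e : OpenPartialHomeomorph X (Quotient s), (⇑e = Quotient.mk s) ∧ e.source = U ∧
      e.target = Quotient.mk s '' U ∧ ∀ y ∈ U, e.symm (Quotient.mk s y) = y := by
  set pe : PartialEquiv X (Quotient s) :=
    (injOn_mk_of_disjoint hs hU).toPartialEquiv (Quotient.mk s) U with hpe
  have hpe_coe : (pe : X → Quotient s) = Quotient.mk s := rfl
  have hpe_src : pe.source = U := rfl
  have hcont : ContinuousOn pe pe.source := continuous_quotient_mk'.continuousOn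
  have hopen : IsOpenMap (pe.source.restrict pe) := by
    intro O hO
    obtain ⟨t, ht, rfl⟩ := isOpen_induced_iff.1 hO
    rw [hpe_src, restrict_eq, image_comp, Subtype.image_preimage_coe, hpe_coe]
    exact isOpen_image_mk hs hσ hc (hUo.inter ht)
  set e := OpenPartialHomeomorph.ofContinuousOpenRestrict pe hcont hopen hUo with he
  refine ⟨e, rfl, rfl, rfl, fun y hy ↦ ?_⟩
  exact e.left_inv (show y ∈ e.source from hy)

/-! ### Descending `σ`-invariant maps -/

/-- **Continuity of the descended map**: if `g` is continuous on the open `σ`-invariant set `W`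
and `g ∘ σ = g` there, then `z ↦ g z.out` is continuous on the open set `q(W)`. [folklore] -/
theorem continuousOn_liftOut {Z : Type*} [TopologicalSpace Z]
    (hs : ∀ x y, s x y ↔ y = x ∨ y = σ x) (hσ : Involutive σ) (hc : Continuous σ)
    {W : Set X} (hWo : IsOpen W) {g : X → Z} (hgc : ContinuousOn g W)
    (hg : ∀ y ∈ W, g (σ y) = g y) :
    ContinuousOn (fun z : Quotient s ↦ g z.out) (Quotient.mk s '' W) := by
  have hqWo : IsOpen (Quotient.mk s '' W) := isOpen_image_mk hs hσ hc hWo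
  rw [continuousOn_open_iff hqWo]
  intro O hO
  -- `q(W) ∩ (g ∘ out)⁻¹ O = q (W ∩ g⁻¹ O)`
  have hset : Quotient.mk s '' W ∩ (fun z : Quotient s ↦ g z.out) ⁻¹' O =
      Quotient.mk s '' (W ∩ g ⁻¹' O) := by
    ext z
    constructor
    · rintro ⟨⟨y, hy, rfl⟩, hz⟩
      refine ⟨y, ⟨hy, ?_⟩, rfl⟩
      rw [mem_preimage, ← liftOut_mk hs hg hy]
      exact hz
    · rintro ⟨y, ⟨hy, hyO⟩, rfl⟩
      refine ⟨mem_image_of_mem _ hy, ?_⟩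
      show g (Quotient.mk s y).out ∈ O
      rw [liftOut_mk hs hg hy]
      exact hyO
  rw [hset]
  exact isOpen_image_mk hs hσ hc ((continuousOn_open_iff hWo).1 hgc O hO)

end Topology

end InvolutionOrbitSpace

end Literature.Topology

end
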